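import Mathlib.LinearAlgebra.Span.Basic
import HarnessLib

/-!
# Cartier modules (Blickle–Böckle 2011, §2)

Topic: `Literature/RingTheory/TightClosure`. For a commutative ring `R` (of prime characteristic
`p`) and `q = p^e`, a **Cartier module** in the sense of Blickle–Böckle is an `R`-module `M` with an
additive structural map `C : M → M` that is `q⁻¹`-linear, `C (r^q m) = r C(m)` — equivalently an
`R`-linear map `F^e_* M → M` (Blickle–Böckle 2011, Def. 2.1; Blickle–Schwede 2012, §8). The
prototypes are `(F^e_* R, φ)` for an `R`-linear `φ : F^e_* R → R` (a Frobenius splitting when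
`φ(1) = 1`; `CartierModuleRing.lean`) and the canonical module `ω_R` with the Cartier operator /
trace of Frobenius.

This file is the affine, module-theoretic core of Blickle–Böckle §2 as DEFINITIONS with their
elementary API (everything stated here is proved):

* `CartierModule p e R M` — the structure (`C`, `map_pow_smul`); `iterate_map_pow_smul`
  (`Cⁿ (r^(p^(e n)) m) = r Cⁿ(m)`);
* `image N` = `C(N)` as an `R`-submodule (it is one: `r C(n) = C(r^q n)`), monotone, additive;
  `IsSubmodule N` (`C(N) ⊆ N`, a *Cartier submodule*), stable under `⊔`, `⊓`, `sSup`, `sInf`, `C(-)`;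
* `iterImage n N = Cⁿ(N)`, the descending chain `M ⊇ C(M) ⊇ C²(M) ⊇ …` (`iterImage_antitone`) and
  the **stable image** `stableImage = ⋂ₙ Cⁿ(M)` (`σ(M)`, Blickle–Böckle's `M̲` of Cor. 2.15; that
  the chain is eventually constant for `M` finitely generated over a Noetherian ring is
  Blickle–Böckle Prop. 2.14 (Gabber), a named fact in `CartierModuleFiniteness.lean`;
  `stableImage_eq_iterImage` / `image_stableImage` record what stabilisation gives);
* `IsSurjective` (`C(M) = M`), `IsNilpotent` (`Cⁿ(M) = 0` for some `n`, Def. 2.7) and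
  `IsNilpotentOn N` (the Cartier submodule `N` is nilpotent).

Rendering choices. The structural map is bundled as data (a `structure`, not a class): one module
carries many Cartier structures (all of `Hom_R(F^e_* R, R)` on `M = R`). `q⁻¹`-linearity is the
additive formulation of Def. 2.1, which needs no Frobenius push-forward of modules and no
characteristic hypothesis to be stated.

What is NOT here: restriction to / quotient by a Cartier submodule, the nilpotent part `M_nil`
and the crystalline support (`CartierModuleNilpotence.lean`); localisation of Cartier structures
(Lemma 2.3) and the sheaf-theoretic language; Cartier crystals (§3); the finiteness theorems
(Prop. 2.14, Thm. 4.6, Prop. 4.9: named facts in `CartierModuleFiniteness.lean`); the examples on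
`M = R` and Fedder-type constructions (`CartierModuleRing.lean`).

## Sources

* [BlickleBockle2011] M. Blickle, G. Böckle, *Cartier modules: finiteness results*, J. reine
  angew. Math. 661 (2011) 85–123 = arXiv:0909.2531 (numbering of the arXiv version, read): Def. 2.1,
  Def. 2.7, Prop. 2.14, Cor. 2.15, Lemma 3.16.
* [BlickleSchwede2012] M. Blickle, K. Schwede, *`p⁻¹`-linear maps in algebra and geometry*, in:
  Commutative Algebra (Springer 2013) 123–205 = arXiv:1205.4577, §8.
-/

noncomputable section

namespace Literature.RingTheory.TightClosure

universe u v

/-- A **Cartier module structure** (at level `e`, for the prime `p`) on the `R`-module `M`: an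
additive map `C : M → M` which is `q⁻¹`-linear for `q = p^e`, i.e. `C (r^q • m) = r • C m`
(Blickle–Böckle: "a quasi-coherent sheaf `M` of `𝒪_X`-modules equipped with a `q⁻¹`-linear map
`C : M → M`, that is an additive map satisfying `C(r^q m) = r C(m)`"; equivalently an `R`-linear
`F^e_* M → M`). [cite: BlickleBockle2011, Def. 2.1] -/
structure CartierModule (p e : ℕ) (R : Type u) (M : Type v) [CommRing R] [AddCommGroup M]
    [Module R M] where
  /-- The structural map `C : M → M`, an additive map. -/
  C : M →+ M
  /-- `q⁻¹`-linearity, `q = p^e`: `C (r^q • m) = r • C m`. -/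
  map_pow_smul' : ∀ (r : R) (m : M), C (r ^ p ^ e • m) = r • C m

namespace CartierModule

variable {p e : ℕ} {R : Type u} {M : Type v} [CommRing R] [AddCommGroup M] [Module R M]

/-- Two Cartier structures with the same structural map are equal. [folklore] -/
@[ext]
theorem ext {𝒞 𝒟 : CartierModule p e R M} (h : ∀ m, 𝒞.C m = 𝒟.C m) : 𝒞 = 𝒟 := by
  cases 𝒞; cases 𝒟
  congr
  exact AddMonoidHom.ext h

/-- `q⁻¹`-linearity of the structural map: `C (r^(p^e) • m) = r • C m`.
[cite: BlickleBockle2011, Def. 2.1] -/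
theorem map_pow_smul (𝒞 : CartierModule p e R M) (r : R) (m : M) :
    𝒞.C (r ^ p ^ e • m) = r • 𝒞.C m :=
  𝒞.map_pow_smul' r m

/-- The iterates `Cⁿ` are `p^(-e n)`-linear: `Cⁿ (r^(p^(e n)) • m) = r • Cⁿ m`.
[cite: BlickleSchwede2012, §8 (the iterated structural map `κⁿ`)] -/
theorem iterate_map_pow_smul (𝒞 : CartierModule p e R M) (n : ℕ) (r : R) (m : M) :
    𝒞.C^[n] (r ^ p ^ (e * n) • m) = r • 𝒞.C^[n] m := by
  induction n generalizing r m with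
  | zero => simp
  | succ n ih =>
    rw [Function.iterate_succ_apply, Function.iterate_succ_apply, Nat.mul_succ, pow_add, pow_mul,
      𝒞.map_pow_smul, ih]

/-! ## Images `C(N)` and Cartier submodules -/

/-- The **image** `C(N)` of a submodule `N` under the structural map; it is again an
`R`-submodule since `r • C n = C (r^q • n)`. [cite: BlickleBockle2011, proof of Prop. 2.14] -/
def image (𝒞 : CartierModule p e R M) (N : Submodule R M) : Submodule R M where
  carrier := 𝒞.C '' N
  zero_mem' := ⟨0, N.zero_mem, map_zero _⟩
  add_mem' := by
    rintro _ _ ⟨a, ha, rfl⟩ ⟨b, hb, rfl⟩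
    exact ⟨a + b, N.add_mem ha hb, map_add _ _ _⟩
  smul_mem' := by
    rintro r _ ⟨a, ha, rfl⟩
    exact ⟨r ^ p ^ e • a, N.smul_mem _ ha, 𝒞.map_pow_smul r a⟩

/-- Membership in `C(N)`. [folklore] -/
theorem mem_image_iff {𝒞 : CartierModule p e R M} {N : Submodule R M} {x : M} :
    x ∈ 𝒞.image N ↔ ∃ m ∈ N, 𝒞.C m = x := by
  show x ∈ 𝒞.C '' N ↔ _
  simp only [Set.mem_image, SetLike.mem_coe]

/-- `C m ∈ C(N)` for `m ∈ N`. [folklore] -/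
theorem apply_mem_image (𝒞 : CartierModule p e R M) {N : Submodule R M} {m : M} (hm : m ∈ N) :
    𝒞.C m ∈ 𝒞.image N :=
  mem_image_iff.mpr ⟨m, hm, rfl⟩

/-- `C(-)` is monotone. [folklore] -/
theorem image_mono (𝒞 : CartierModule p e R M) : Monotone 𝒞.image :=
  fun _ _ h _ hx => by
    obtain ⟨m, hm, rfl⟩ := mem_image_iff.mp hx
    exact 𝒞.apply_mem_image (h hm)

/-- `C(0) = 0`. [folklore] -/
theorem image_bot (𝒞 : CartierModule p e R M) : 𝒞.image ⊥ = ⊥ := by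
  refine le_antisymm (fun x hx => ?_) bot_le
  obtain ⟨m, hm, rfl⟩ := mem_image_iff.mp hx
  rw [(Submodule.mem_bot R).mp hm, map_zero]
  exact Submodule.zero_mem _

/-- `C(N ⊔ N') = C(N) ⊔ C(N')` (`C` is additive). [folklore] -/
theorem image_sup (𝒞 : CartierModule p e R M) (N N' : Submodule R M) :
    𝒞.image (N ⊔ N') = 𝒞.image N ⊔ 𝒞.image N' := by
  refine le_antisymm (fun x hx => ?_)
    (sup_le (𝒞.image_mono le_sup_left) (𝒞.image_mono le_sup_right))
  obtain ⟨m, hm, rfl⟩ := mem_image_iff.mp hx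
  obtain ⟨a, ha, b, hb, rfl⟩ := Submodule.mem_sup.mp hm
  rw [map_add]
  exact Submodule.add_mem_sup (𝒞.apply_mem_image ha) (𝒞.apply_mem_image hb)

/-- `C(⨆ᵢ Nᵢ) = ⨆ᵢ C(Nᵢ)` (`C` is additive). [folklore] -/
theorem image_iSup (𝒞 : CartierModule p e R M) {ι : Sort*} (N : ι → Submodule R M) :
    𝒞.image (⨆ i, N i) = ⨆ i, 𝒞.image (N i) := by
  refine le_antisymm (fun x hx => ?_) (iSup_le fun i => 𝒞.image_mono (le_iSup N i))
  rw [mem_image_iff] at hx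
  obtain ⟨m, hm, rfl⟩ := hx
  induction hm using Submodule.iSup_induction' with
  | mem i m hm => exact Submodule.mem_iSup_of_mem i (𝒞.apply_mem_image hm)
  | zero => rw [map_zero]; exact Submodule.zero_mem _
  | add a b _ _ ha hb => rw [map_add]; exact Submodule.add_mem _ ha hb

/-- `N` is a **Cartier submodule** of `(M, C)`: `C(N) ⊆ N`. [cite: BlickleBockle2011, Def. 2.1
(Cartier submodules = sub-objects, i.e. `C`-stable `𝒪_X`-submodules)] -/
def IsSubmodule (𝒞 : CartierModule p e R M) (N : Submodule R M) : Prop :=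
  𝒞.image N ≤ N

/-- `C(N) ⊆ N` elementwise. [folklore] -/
theorem isSubmodule_iff {𝒞 : CartierModule p e R M} {N : Submodule R M} :
    𝒞.IsSubmodule N ↔ ∀ m ∈ N, 𝒞.C m ∈ N :=
  ⟨fun h _ hm => h (𝒞.apply_mem_image hm), fun h _ hx => by
    obtain ⟨m, hm, rfl⟩ := mem_image_iff.mp hx
    exact h m hm⟩

/-- `M` itself is a Cartier submodule. [folklore] -/
theorem isSubmodule_top (𝒞 : CartierModule p e R M) : 𝒞.IsSubmodule ⊤ := le_top

/-- `0` is a Cartier submodule. [folklore] -/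
theorem isSubmodule_bot (𝒞 : CartierModule p e R M) : 𝒞.IsSubmodule ⊥ := (𝒞.image_bot).le

/-- Cartier submodules are stable under `⊓`. [folklore] -/
theorem IsSubmodule.inf {𝒞 : CartierModule p e R M} {N N' : Submodule R M} (h : 𝒞.IsSubmodule N)
    (h' : 𝒞.IsSubmodule N') : 𝒞.IsSubmodule (N ⊓ N') :=
  le_inf ((𝒞.image_mono inf_le_left).trans h) ((𝒞.image_mono inf_le_right).trans h')

/-- Cartier submodules are stable under `⊔`. [folklore] -/
theorem IsSubmodule.sup {𝒞 : CartierModule p e R M} {N N' : Submodule R M} (h : 𝒞.IsSubmodule N)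
    (h' : 𝒞.IsSubmodule N') : 𝒞.IsSubmodule (N ⊔ N') := by
  unfold IsSubmodule
  rw [𝒞.image_sup]
  exact sup_le_sup h h'

/-- Cartier submodules are stable under arbitrary intersections. [folklore] -/
theorem isSubmodule_sInf {𝒞 : CartierModule p e R M} {S : Set (Submodule R M)}
    (h : ∀ N ∈ S, 𝒞.IsSubmodule N) : 𝒞.IsSubmodule (sInf S) :=
  le_sInf fun N hN => ((𝒞.image_mono (sInf_le hN)).trans (h N hN))

/-- Cartier submodules are stable under arbitrary sums. [folklore] -/
theorem isSubmodule_iSup {𝒞 : CartierModule p e R M} {ι : Sort*} {N : ι → Submodule R M}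
    (h : ∀ i, 𝒞.IsSubmodule (N i)) : 𝒞.IsSubmodule (⨆ i, N i) := by
  unfold IsSubmodule
  rw [𝒞.image_iSup]
  exact iSup_mono h

/-- Cartier submodules are stable under arbitrary sums (set form). [folklore] -/
theorem isSubmodule_sSup {𝒞 : CartierModule p e R M} {S : Set (Submodule R M)}
    (h : ∀ N ∈ S, 𝒞.IsSubmodule N) : 𝒞.IsSubmodule (sSup S) := by
  rw [sSup_eq_iSup']
  exact isSubmodule_iSup fun N => h N.1 N.2

/-- The image `C(N)` of a Cartier submodule is a Cartier submodule. [cite: BlickleBockle2011,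
proof of Prop. 2.14 ("`Cⁱ(M)` is … even a coherent Cartier submodule of `M`")] -/
theorem IsSubmodule.image {𝒞 : CartierModule p e R M} {N : Submodule R M} (h : 𝒞.IsSubmodule N) :
    𝒞.IsSubmodule (𝒞.image N) :=
  𝒞.image_mono h

/-! ## Iterated images, the stable image, surjectivity, nilpotence -/

/-- The **iterated image** `Cⁿ(N)`. [cite: BlickleBockle2011, Prop. 2.14] -/
def iterImage (𝒞 : CartierModule p e R M) (n : ℕ) (N : Submodule R M) : Submodule R M :=
  𝒞.image^[n] N

/-- `C⁰(N) = N`. [folklore] -/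
theorem iterImage_zero (𝒞 : CartierModule p e R M) (N : Submodule R M) : 𝒞.iterImage 0 N = N :=
  rfl

/-- `Cⁿ⁺¹(N) = C(Cⁿ(N))`. [folklore] -/
theorem iterImage_succ (𝒞 : CartierModule p e R M) (n : ℕ) (N : Submodule R M) :
    𝒞.iterImage (n + 1) N = 𝒞.image (𝒞.iterImage n N) :=
  Function.iterate_succ_apply' 𝒞.image n N

/-- Membership in `Cⁿ(N)`: the values of the `n`-th iterate of `C` on `N`. [folklore] -/
theorem mem_iterImage_iff {𝒞 : CartierModule p e R M} {n : ℕ} {N : Submodule R M} {x : M} :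
    x ∈ 𝒞.iterImage n N ↔ ∃ m ∈ N, 𝒞.C^[n] m = x := by
  induction n generalizing x with
  | zero => simp [iterImage_zero]
  | succ n ih =>
    rw [iterImage_succ, mem_image_iff]
    constructor
    · rintro ⟨y, hy, rfl⟩
      obtain ⟨m, hm, rfl⟩ := ih.mp hy
      exact ⟨m, hm, Function.iterate_succ_apply' 𝒞.C n m⟩
    · rintro ⟨m, hm, rfl⟩
      exact ⟨_, ih.mpr ⟨m, hm, rfl⟩, (Function.iterate_succ_apply' 𝒞.C n m).symm⟩

/-- Each `Cⁿ(N)` is a Cartier submodule when `N` is. [cite: BlickleBockle2011, proof of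
Prop. 2.14] -/
theorem isSubmodule_iterImage {𝒞 : CartierModule p e R M} {N : Submodule R M}
    (h : 𝒞.IsSubmodule N) (n : ℕ) : 𝒞.IsSubmodule (𝒞.iterImage n N) := by
  induction n with
  | zero => exact h
  | succ n ih => rw [iterImage_succ]; exact ih.image

/-- **The descending chain of images** `N ⊇ C(N) ⊇ C²(N) ⊇ …` of a Cartier submodule.
[cite: BlickleBockle2011, Prop. 2.14] -/
theorem iterImage_antitone {𝒞 : CartierModule p e R M} {N : Submodule R M}
    (h : 𝒞.IsSubmodule N) : Antitone fun n => 𝒞.iterImage n N :=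
  antitone_nat_of_succ_le fun n => by
    rw [iterImage_succ]
    exact isSubmodule_iterImage h n

/-- `Cⁿ` is monotone in the submodule. [folklore] -/
theorem iterImage_mono (𝒞 : CartierModule p e R M) (n : ℕ) : Monotone (𝒞.iterImage n) := by
  induction n with
  | zero => exact fun _ _ h => h
  | succ n ih => intro N N' h; rw [iterImage_succ, iterImage_succ]; exact 𝒞.image_mono (ih h)

/-- `Cᵐ⁺ⁿ(N) = Cᵐ(Cⁿ(N))`. [folklore] -/
theorem iterImage_add (𝒞 : CartierModule p e R M) (m n : ℕ) (N : Submodule R M) :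
    𝒞.iterImage (m + n) N = 𝒞.iterImage m (𝒞.iterImage n N) :=
  Function.iterate_add_apply 𝒞.image m n N

/-- The **stable image** `σ(M) = ⋂ₙ Cⁿ(M)` (Blickle–Böckle's `M̲`; equal to `Cⁿ(M)` for `n ≫ 0`
once the chain of images is eventually constant, Prop. 2.14). [cite: BlickleBockle2011, Cor. 2.15] -/
def stableImage (𝒞 : CartierModule p e R M) : Submodule R M :=
  ⨅ n, 𝒞.iterImage n ⊤

/-- `σ(M) ⊆ Cⁿ(M)` for every `n`. [folklore] -/
theorem stableImage_le (𝒞 : CartierModule p e R M) (n : ℕ) : 𝒞.stableImage ≤ 𝒞.iterImage n ⊤ :=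
  iInf_le _ n

/-- `σ(M)` is a Cartier submodule. [cite: BlickleBockle2011, Cor. 2.15] -/
theorem isSubmodule_stableImage (𝒞 : CartierModule p e R M) : 𝒞.IsSubmodule 𝒞.stableImage :=
  le_iInf fun n => (𝒞.image_mono (𝒞.stableImage_le n)).trans
    (by rw [← iterImage_succ]; exact iterImage_antitone 𝒞.isSubmodule_top n.le_succ)

/-- If the chain of images is constant from `n₀` on (`Cⁿ⁰⁺¹(M) = Cⁿ⁰(M)`), then it is constant
for all `n ≥ n₀`. [cite: BlickleBockle2011, Cor. 2.15 (proof)] -/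
theorem iterImage_eq_of_stable {𝒞 : CartierModule p e R M} {n₀ : ℕ}
    (h : 𝒞.iterImage (n₀ + 1) ⊤ = 𝒞.iterImage n₀ ⊤) {n : ℕ} (hn : n₀ ≤ n) :
    𝒞.iterImage n ⊤ = 𝒞.iterImage n₀ ⊤ := by
  obtain ⟨d, rfl⟩ := Nat.exists_eq_add_of_le hn
  induction d with
  | zero => rfl
  | succ d ih => rw [← Nat.add_assoc, iterImage_succ, ih (Nat.le_add_right _ _), ← iterImage_succ, h]

/-- If the chain of images is constant from `n₀` on, the stable image is `Cⁿ⁰(M)`.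
[cite: BlickleBockle2011, Cor. 2.15 (proof: "the stable image `M̲ := Cᵉ(M)` for `e ≫ 0`")] -/
theorem stableImage_eq_iterImage {𝒞 : CartierModule p e R M} {n₀ : ℕ}
    (h : 𝒞.iterImage (n₀ + 1) ⊤ = 𝒞.iterImage n₀ ⊤) : 𝒞.stableImage = 𝒞.iterImage n₀ ⊤ := by
  refine le_antisymm (𝒞.stableImage_le n₀) (le_iInf fun n => ?_)
  rcases le_total n₀ n with hn | hn
  · rw [iterImage_eq_of_stable h hn]
  · exact iterImage_antitone 𝒞.isSubmodule_top hn

/-- If the chain of images is constant from `n₀` on, the structural map is surjective on the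
stable image: `C(σ(M)) = σ(M)`. [cite: BlickleBockle2011, Cor. 2.15 (b)] -/
theorem image_stableImage {𝒞 : CartierModule p e R M} {n₀ : ℕ}
    (h : 𝒞.iterImage (n₀ + 1) ⊤ = 𝒞.iterImage n₀ ⊤) : 𝒞.image 𝒞.stableImage = 𝒞.stableImage := by
  rw [stableImage_eq_iterImage h, ← iterImage_succ, h]

/-- The structural map is **surjective**: `C(M) = M`. [cite: BlickleBockle2011, Cor. 2.15 (b)] -/
def IsSurjective (𝒞 : CartierModule p e R M) : Prop :=
  𝒞.image ⊤ = ⊤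

/-- `C(M) = M` iff `C` is surjective as a map. [folklore] -/
theorem isSurjective_iff {𝒞 : CartierModule p e R M} :
    𝒞.IsSurjective ↔ Function.Surjective 𝒞.C := by
  simp only [IsSurjective, Submodule.eq_top_iff', mem_image_iff, Submodule.mem_top, true_and]
  rfl

/-- For surjective `C` all iterated images are `M`. [folklore] -/
theorem IsSurjective.iterImage_top {𝒞 : CartierModule p e R M} (h : 𝒞.IsSurjective) (n : ℕ) :
    𝒞.iterImage n ⊤ = ⊤ := by
  induction n with
  | zero => rfl
  | succ n ih => rw [iterImage_succ, ih]; exact h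

/-- `(M, C)` is **nilpotent**: `Cⁿ(M) = 0` for some `n`. [cite: BlickleBockle2011, Def. 2.7] -/
def IsNilpotent (𝒞 : CartierModule p e R M) : Prop :=
  ∃ n : ℕ, 𝒞.iterImage n ⊤ = ⊥

/-- The Cartier submodule `N` is **nilpotent** (as a Cartier module): `Cⁿ(N) = 0` for some `n`.
[cite: BlickleBockle2011, Def. 2.7] -/
def IsNilpotentOn (𝒞 : CartierModule p e R M) (N : Submodule R M) : Prop :=
  ∃ n : ℕ, 𝒞.iterImage n N = ⊥

/-- Nilpotence elementwise: some iterate of `C` vanishes identically. [cite: BlickleBockle2011,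
Def. 2.7] -/
theorem isNilpotent_iff {𝒞 : CartierModule p e R M} :
    𝒞.IsNilpotent ↔ ∃ n : ℕ, ∀ m : M, 𝒞.C^[n] m = 0 := by
  refine exists_congr fun n => ?_
  rw [Submodule.eq_bot_iff]
  exact ⟨fun h m => h _ (mem_iterImage_iff.mpr ⟨m, trivial, rfl⟩), fun h x hx => by
    obtain ⟨m, -, rfl⟩ := mem_iterImage_iff.mp hx
    exact h m⟩

/-- `M` is nilpotent iff it is nilpotent as its own Cartier submodule. [folklore] -/
theorem isNilpotent_iff_isNilpotentOn_top {𝒞 : CartierModule p e R M} :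
    𝒞.IsNilpotent ↔ 𝒞.IsNilpotentOn ⊤ :=
  Iff.rfl

/-- A Cartier module with surjective structural map is nilpotent only if it is zero.
[cite: BlickleBockle2011, Lemma 3.16 (proof)] -/
theorem IsSurjective.subsingleton_of_isNilpotent {𝒞 : CartierModule p e R M} (h : 𝒞.IsSurjective)
    (hn : 𝒞.IsNilpotent) : Subsingleton M := by
  obtain ⟨n, hn⟩ := hn
  rw [h.iterImage_top n] at hn
  exact (Submodule.subsingleton_iff R).mp (subsingleton_of_top_le_bot hn.le)

end CartierModule

end Literature.RingTheory.TightClosure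

end
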